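import Mathlib.LinearAlgebra.FiniteDimensional.Lemmas
import Mathlib.LinearAlgebra.Dimension.Finrank
import HarnessLib

/-!
# Crux `ThetaLayerLambdaCongruenceAtTwo` (stmt-BirchSwinnertonDyer-20688, route ResidualThetaTransportAtTwo), line
# `birth`: the PLUS-LINE linear algebra behind (C3) — on a `2`-dimensional space, the fixed vectors of a
# non-identity endomorphism (complex conjugation acting on `J[𝔪'] ≅ ρ̄` as a TRANSVECTION when `Δ_W < 0`) form a line,
# so two non-zero fixed vectors are proportional (width prover bsd-wall-rtt-p3-w2 g0;
# `--supports stmt-BirchSwinnertonDyer-20688 --as helper`; closes nothing)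

HONEST FRAMING. Pure linear algebra; nothing about any curve or form is asserted; BSD is not proved by any of this.

WHAT. The `p = 2` substitute for the `±` decomposition in Vatsal (1.10) / Greenberg–Vatsal §3 (lead's stub (C3),
«plus multiplicity one mod 2»): multiplicity one gives `J₁(N')[𝔪'] ≅ ρ̄`, a `2`-dimensional `𝔽̄₂`-space on which complex
conjugation `c` acts; on the habitat⁺ (`Δ_W < 0`) `ρ̄(c) ≠ 1` (a transposition of the three `2`-division points), so
the `c`-FIXED vectors — where the reductions of the PLUS symbols of `W` and of `g` live — form a LINE, and two non-zero
ones differ by a unit: `exists_smul_eq_of_fixed_of_ne_id`. (In characteristic `2` an involution `c ≠ 1` on a plane is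
automatically a transvection, `(c − 1)² = 0`; only `c ≠ 1` is used.)

References: [Vatsal1999] §1.3–1.5 (the ± parts); [GreenbergVatsal2000] §3; [RibetStein2008] Thm. 3.5 (multiplicity one).
-/

-- justification: the `Summit.BirchSwinnertonDyer.BirchSwinnertonDyer.…` path repeats a component (route-file convention)
set_option linter.dupNamespace false

namespace Summit.BirchSwinnertonDyer.BirchSwinnertonDyer.Theorems.ThetaLayerLambdaCongruenceAtTwo

section PlusLine

variable {k V : Type*} [Field k] [AddCommGroup V] [Module k V] [FiniteDimensional k V]

/-- **The fixed space of a non-identity endomorphism of a plane is at most a line.** [folklore] -/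
theorem finrank_ker_sub_id_le_one (h2 : Module.finrank k V = 2) (c : V →ₗ[k] V) (hc : c ≠ LinearMap.id) :
    Module.finrank k (LinearMap.ker (c - LinearMap.id)) ≤ 1 := by
  have hne : LinearMap.ker (c - LinearMap.id) ≠ ⊤ := by
    intro htop
    apply hc
    ext v
    have hv : v ∈ LinearMap.ker (c - LinearMap.id) := htop ▸ Submodule.mem_top
    simpa [sub_eq_zero] using hv
  have h := Submodule.finrank_lt hne
  omega

/-- **Two non-zero vectors fixed by a non-identity endomorphism of a plane are proportional**: if `dim V = 2`,
`c ≠ 1`, `c x = x`, `c y = y` and `x ≠ 0`, then `y = u • x` for some scalar `u` (and `u ≠ 0` iff `y ≠ 0`). This is the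
plus-line step of (C3): the reductions mod `𝔪'` of the (conjugation-fixed) plus symbols of `W` and `g` lie on one
`𝔽̄₂`-line of `J[𝔪'] ≅ ρ̄` because `ρ̄(conj) ≠ 1` when `Δ_W < 0`. [cite: Vatsal1999, §1.3–1.5 (the ± decomposition; here its p = 2 substitute)] -/
theorem exists_smul_eq_of_fixed_of_ne_id (h2 : Module.finrank k V = 2) (c : V →ₗ[k] V) (hc : c ≠ LinearMap.id)
    {x y : V} (hx : c x = x) (hy : c y = y) (hx0 : x ≠ 0) : ∃ u : k, y = u • x := by
  have hxF : x ∈ LinearMap.ker (c - LinearMap.id) := by simp [hx]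
  have hyF : y ∈ LinearMap.ker (c - LinearMap.id) := by simp [hy]
  obtain ⟨v, hv⟩ := finrank_le_one_iff.mp (finrank_ker_sub_id_le_one h2 c hc)
  obtain ⟨a, ha⟩ := hv ⟨x, hxF⟩
  obtain ⟨b, hb⟩ := hv ⟨y, hyF⟩
  have ha' : a • (v : V) = x := by simpa using congrArg Subtype.val ha
  have hb' : b • (v : V) = y := by simpa using congrArg Subtype.val hb
  have ha0 : a ≠ 0 := by
    rintro rfl
    exact hx0 (by rw [← ha', zero_smul])
  refine ⟨b * a⁻¹, ?_⟩
  rw [← hb', ← ha', smul_smul, mul_assoc, inv_mul_cancel₀ ha0, mul_one]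

/-- The unit version: if moreover `y ≠ 0` then the scalar is non-zero. [folklore] -/
theorem exists_ne_zero_smul_eq_of_fixed_of_ne_id (h2 : Module.finrank k V = 2) (c : V →ₗ[k] V)
    (hc : c ≠ LinearMap.id) {x y : V} (hx : c x = x) (hy : c y = y) (hx0 : x ≠ 0) (hy0 : y ≠ 0) :
    ∃ u : k, u ≠ 0 ∧ y = u • x := by
  obtain ⟨u, hu⟩ := exists_smul_eq_of_fixed_of_ne_id h2 c hc hx hy hx0
  refine ⟨u, ?_, hu⟩
  rintro rfl
  exact hy0 (by rw [hu, zero_smul])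

end PlusLine

end Summit.BirchSwinnertonDyer.BirchSwinnertonDyer.Theorems.ThetaLayerLambdaCongruenceAtTwo
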